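/-
Copyright (c) 2026 the pub-hodgecm-mathlib formalisation cell (harness21).  Prover seat hodgecm-mathlib-K2Liu-p02 (g2),
Track B «K2-LIT» ∕ hLiu418 #184♮, unit U6 «FIRST TERM», socket #42 `sig_K2LiuEisensteinResidueIsThetaIntegral` (steward): organ O42.1
«CENTRE ABSORPTION» of the REPORT-FIRST memo `K2/K2Liu-p02/g2/REPORT-FIRST-42-EisensteinResidueIsThetaIntegral.K2Liup02g2.md` §−1 ∕ §3.  2026-09-04.
-/
import Literature.NumberTheory.K2Lit.DoubledLineThetaKernel                 -- ★ D8: `doubledLineThetaLift ∕ Integral`, `toDiagA`, `dD`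
import Literature.NumberTheory.Automorphic.Liu2021.ThetaLiftFromLineCentralCharacter  -- ★ T5b: `adelicInl_adelicCenter_eq_adelicInr_adelicCenter`, `pairSplitting∕pairRep_adelicCenter_fst_eq_snd`
import Literature.NumberTheory.Automorphic.UnitaryGroupAdelicLineTorus       -- ★ `adelicDet`, `coe_eq_det_smul_one` (a line is its centre)
import HarnessLib

/-!
# K2_Liu road (hLiu418 = stmt-HodgeConjecture-24832), unit U6 «FIRST TERM», organ O42.1: centre absorption in the theta kernels of a
# unitary dual pair, and the central invariance of the DOUBLED LINE THETA INTEGRAL of leaf D8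

Cell `pub/hodgecm-mathlib` (D-0151), Track B; socket module `Cruxes/HLiu418/Lines/K2_Liu_CurveThetaSigs_U6_FirstTerm.lean` ED. 4, socket #42
`sig_K2LiuEisensteinResidueIsThetaIntegral` (STEWARD K2Liu-p02 (g2), LEAD F0P6-plan DEAL 2026-09-03T23:26:09Z).  This file is the kernel-checked
core of the steward's finding «CENTRE WEIGHT» (REPORT-FIRST §−1): in the tree every theta kernel of a pair `U(J_V)(rank N) × U(J_W)(rank M)` is
built from ONE homomorphism `s` on the big group `U(J_V ⊗ J_W)(𝔸)` (★ `UnitaryDualPair.pairSplitting`), and the two CENTRES `u·1_V`, `u·1_W`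
(`u ∈ U(1)(𝔸_{L⁺})`, ★ `UnitaryGroup.adelicCenter`) have the SAME image `u·1` there (★ `Liu2021.adelicInl_adelicCenter_eq_adelicInr_adelicCenter`,
T5b lineage `ThetaLiftFromLineCentralCharacter`, where the consequence for theta lifts of CHARACTERS is drawn: ★ `centralCharacter_eq_charCM`);
hence a central translate in the `U(J_V)`-slot of the kernel IS a central translate in the `U(J_W)`-slot, and for a hermitian LINE
(`M = 1`, every element central: ★ `UnitaryGroupAdelicLineTorus`) the whole `q`-variable is a central translate of the `U(J_V)`-variable.
Consequence for leaf D8 (`K2Lit/DoubledLineThetaKernel`): the weight-`1` theta integral `I(h; Φ) = ∫_{[U(⟨a′⟩)]} θ_Φ((toDiagA h)⁻¹Γ, q) dμW`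
of an `U(⟨a′⟩)(𝔸)`-INVARIANT measure is INVARIANT under the centre of `H(𝔸) = U(𝔻)(𝔸)`, while the residue of the Siegel Eisenstein series
has central character `χ_λ(u)^2` (organ O42.2) — which is why socket #42 needs the weighted lift ★ `doubledLineThetaLift … f` (ED. 5).

* §1 (generic dual pair `U(J_V) × U(J_W)` over any quadratic datum `(F, E, c)`; the identity `(u·1_V) ⊗ 1 = 1 ⊗ (u·1_W)` and the case
  `x = y = 1` are ★ `Liu2021.adelicInl_adelicCenter_eq_adelicInr_adelicCenter` ∕ `pairSplitting_adelicCenter_fst_eq_snd` of the T5b lineage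
  `ThetaLiftFromLineCentralCharacter`, REUSED) `pairSplitting_adelicCenter_swap ∕ pairRep_adelicCenter_swap` (`s_pair(x·u1_V, y) = s_pair(x, u1_W·y)`),
  `pairRep_adelicCenter_inv` (the inverse shape produced by Weil's translation laws), `adelicCenter_adelicDet_rankOne` — a hermitian LINE is its
  own centre (`y = (det y)·1₁`; the surjectivity form is ★ `F0P6LD1ThetaCharacterPin.exists_adelicCenter_JW_eq`).
* §2 (the letter's datum ★ `lineThetaKernelDatum L N e₁ dV … μ hμ a hρ`, any rank `N`, any `λ`, any line `⟨a⟩`) `lineThetaKer_adelicCenter_smul` —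
  `θ_Φ((u·1_V) • ξ, q) = θ_Φ(ξ, (u·1_W) • q)`: with §1's rank-one lemma, THE `q`-VARIABLE IS A CENTRAL TRANSLATE OF THE `ξ`-VARIABLE (the
  `L²`-class form for CHARACTER weights is ★ `rightRegular_adelicCenter_toLp_lineThetaLift_charCM` of the same lineage).
* §3 (leaf D8) `doubledLineThetaLift_mul_centre` — `Θ̃_Φ(f)(h · z_u) = Θ̃_Φ(λ((u·1_W)⁻¹) f)(h)` for the central `z_u = toDiagA⁻¹(u·1_𝔻) ∈ H(𝔸)`
  (`λ(k)f = f(k⁻¹ • ·)`, ★ `Weil1964.leftTranslate`; change of variables against the invariant `μW`, Mathlib `integral_smul_eq_self`), and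
  **`doubledLineThetaIntegral_mul_centre`**: `I(h · z_u; Φ) = I(h; Φ)` — the weight-`1` theta integral is invariant under the centre of `H(𝔸)`.

All statements are over ★ carriers; Mathlib + tree lemmas only; no `sorry`, no new definition except the abbreviation-free central element
spelled inline.  HONEST LABEL: HC_CM is proved only modulo the 7 printed citations (2 remaining named inputs: hLiu418 = stmt-HodgeConjecture-24832,
h413 = stmt-HodgeConjecture-24833) until rung 0 closes; this file is a `--supports stmt-HodgeConjecture-24832` helper and retires nothing by itself.

References: [GelbartRogawski1991] S. Gelbart, J. Rogawski, Invent. Math. 105 (1991) §3.1 Remark p. 457, §3.2 p. 457 (for `dim W = 1` the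
group `U(W)` is the centre `E¹`); [Mok2014] C. P. Mok, Mem. AMS 235, §1 Notation p. 5; [Weil1964] A. Weil, Acta Math. 111, n° 41 Thm 6 p. 193;
[Liu2021] Y. Liu, Camb. J. Math. 9 (2021) App. B p. 104 («pair of splitting characters (μᶜ, 1)»); [HarrisKudlaSweet1996] §1 (1.14)–(1.16).
-/

set_option autoImplicit false
set_option linter.dupNamespace false
-- statements over the adelic dual-pair carriers elaborate to very large types; elaborate sequentially (as in ★ `K2LiuSeesawFubini`)
set_option Elab.async false

noncomputable section

open NumberField MeasureTheory IsDedekindDomain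
open scoped Matrix ComplexOrder

namespace Summit.HodgeConjecture.HodgeConjecture.Cruxes.HLiu418.K2LiuLineThetaCentreAbsorb

open Literature.NumberTheory.Automorphic Literature.NumberTheory.Automorphic.UnitaryGroup
open Literature.NumberTheory.Automorphic.IdeleClassGroup
open Literature.NumberTheory.Automorphic.Liu2021
open Literature.NumberTheory.Automorphic.Liu2021.Def411WeilCarriers
open Literature.NumberTheory.Automorphic.Liu2021.Def411WeilCarriersDoubling
open Literature.NumberTheory.GelbartRogawski1991 Literature.NumberTheory.GelbartRogawski1991.UnitaryDualPair
open Literature.NumberTheory.Weil1964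
open Literature.RepresentationTheory.Liu2021

/-! ## §1 The centre moves between the two slots of the pair -/

section Pair

variable (F E : Type) [Field F] [NumberField F] [Field E] [NumberField E] [Algebra F E]
variable (c : E ≃ₐ[F] E) (N M : ℕ) {n : ℕ} (e : Fin N × Fin M ≃ Fin n)
variable (JV : Matrix (Fin N) (Fin N) E) (JW : Matrix (Fin M) (Fin M) E)

variable {TV : Matrix (Fin N) (Fin N) F} {TW : Matrix (Fin M) (Fin M) F}

/-- **The centre moves between the slots of the pair splitting**: `s_pair(x · u1_V, y) = s_pair(x, u1_W · y)`.
[cite: GelbartRogawski1991, §3.1 Remark p. 457] -/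
theorem pairSplitting_adelicCenter_swap
    (s : UnitaryGroup.adelicPair F E c N M JV JW →* adelicMpCont F (Fin n) (adelicGram F e TV TW))
    (x : adelic F E c N JV) (y : adelic F E c M JW) (u : adelicOne F E c) :
    pairSplitting F E c N M e JV JW s (x * adelicCenter F E c N JV u, y) =
      pairSplitting F E c N M e JV JW s (x, adelicCenter F E c M JW u * y) := by
  have h1 : adelicInl F E c N M JV JW (x * adelicCenter F E c N JV u) * adelicInr F E c N M JV JW y =
      adelicInl F E c N M JV JW x * adelicInr F E c N M JV JW (adelicCenter F E c M JW u * y) := by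
    rw [map_mul, map_mul, adelicInl_adelicCenter_eq_adelicInr_adelicCenter F E c N M JV JW u, mul_assoc]
  simp only [pairSplitting_apply, h1]

/-- **`ω ∘ s_pair` on the two centres agrees**: `(ω ∘ s_pair)(x · u1_V, y) = (ω ∘ s_pair)(x, u1_W · y)`.
[cite: GelbartRogawski1991, §3.1 Remark p. 457] [cite: Weil1964, Chap. III n° 41 p. 193] -/
theorem pairRep_adelicCenter_swap
    (s : UnitaryGroup.adelicPair F E c N M JV JW →* adelicMpCont F (Fin n) (adelicGram F e TV TW))
    (x : adelic F E c N JV) (y : adelic F E c M JW) (u : adelicOne F E c) :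
    pairRep F E c N M e JV JW s (x * adelicCenter F E c N JV u, y) = pairRep F E c N M e JV JW s (x, adelicCenter F E c M JW u * y) := by
  simp only [pairRep, MonoidHom.comp_apply, pairSplitting_adelicCenter_swap F E c N M e JV JW s x y u]

/-- inverse form at `x = y = 1` (the shape produced by Weil's translation laws ★ `thetaKer_smul_left ∕ _right`):
`(ω ∘ s_pair)((u1_V)⁻¹, 1) = (ω ∘ s_pair)(1, (u1_W)⁻¹)`. [cite: GelbartRogawski1991, §3.1 Remark p. 457] -/
theorem pairRep_adelicCenter_inv
    (s : UnitaryGroup.adelicPair F E c N M JV JW →* adelicMpCont F (Fin n) (adelicGram F e TV TW)) (u : adelicOne F E c)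
    (Φ : piSchwartzBruhat F (Fin n)) :
    pairRep F E c N M e JV JW s ((adelicCenter F E c N JV u)⁻¹, 1) Φ = pairRep F E c N M e JV JW s (1, (adelicCenter F E c M JW u)⁻¹) Φ := by
  have h1 : adelicInl F E c N M JV JW (adelicCenter F E c N JV u)⁻¹ * adelicInr F E c N M JV JW 1 =
      adelicInl F E c N M JV JW 1 * adelicInr F E c N M JV JW (adelicCenter F E c M JW u)⁻¹ := by
    rw [map_one, map_one, mul_one, one_mul, map_inv, map_inv, adelicInl_adelicCenter_eq_adelicInr_adelicCenter F E c N M JV JW u]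
  simp only [pairRep, MonoidHom.comp_apply, pairSplitting_apply, h1]

omit [NumberField F] in
/-- **a hermitian LINE is its own centre**: for a `1 × 1` form `J` with `det J ≠ 0`, every `y ∈ U(J)(𝔸_F)` is the central element
`(det y) · 1₁` (★ `coe_eq_det_smul_one`; cf. ★ `adelicLineEquiv`). [cite: Mok2014, §1 Notation p. 5] -/
theorem adelicCenter_adelicDet_rankOne (J : Matrix (Fin 1) (Fin 1) E) (hJ : J.det ≠ 0) (y : adelic F E c 1 J) :
    adelicCenter F E c 1 J (adelicDet F E c 1 J hJ y) = y :=
  Subtype.ext (Units.ext (((coe_adelicCenter F E c 1 J _).trans (by rw [coe_coe_adelicDet])).trans (coe_eq_det_smul_one E _).symm))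

end Pair

/-! ## §2 Kernel level, for the letter's line-theta datum ★ `lineThetaKernelDatum` (any rank `N`, any diagonal `dV`, any `λ`, any line `⟨a⟩`) -/

section Line

variable (L : Type) [Field L] [NumberField L] [IsCMField L] (N : ℕ) {n' : ℕ} (e₁ : Fin N × Fin 1 ≃ Fin n')
  (dV : Fin N → L) (hdV : ∀ i, IsCMField.complexConj L (dV i) = dV i) (hdV0 : ∀ i, dV i ≠ 0)
  (μ : Literature.NumberTheory.Automorphic.IdeleClassGroup L →ₜ* Circle) (hμ : IsConjugateSymplectic L μ)
  (a : (↥(maximalRealSubfield L))ˣ)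
  (hρ : HasThetaMajorants fun
      (p : ↥(UnitaryGroup.adelic (↥(maximalRealSubfield L)) L (IsCMField.complexConj L) N (Matrix.diagonal dV)) ×
        ↥(UnitaryGroup.adelic (↥(maximalRealSubfield L)) L (IsCMField.complexConj L) 1 (JW (↥(maximalRealSubfield L)) L a)))
      (Φ : piSchwartzBruhat (↥(maximalRealSubfield L)) (Fin n')) =>
        pairRep (↥(maximalRealSubfield L)) L (IsCMField.complexConj L) N 1 e₁ (Matrix.diagonal dV) (JW (↥(maximalRealSubfield L)) L a)
          (chiSplittingLine L e₁ dV hdV hdV0 (toHeckeCharacter L μ) (isUnitary_toHeckeCharacter L μ)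
            ((isOscillatorChar_toHeckeCharacter_iff μ).mpr hμ) (TW (↥(maximalRealSubfield L)) a)
            (isUnit_det_TW (↥(maximalRealSubfield L)) a) (JW (↥(maximalRealSubfield L)) L a) (JW_eq (↥(maximalRealSubfield L)) L a))
          p Φ)

set_option maxHeartbeats 1000000 in -- the theta-kernel datum's statement telescope (cf. ★ `K2LiuSeesawFubini`)
/-- **CENTRE ABSORPTION for the line-theta kernel** (any rank `N`, any `λ`): `θ_Φ((u·1_V) • ξ, q) = θ_Φ(ξ, (u·1_W) • q)` — a central
translate in the `U(V)`-slot IS the same central translate in the `U(⟨a⟩)`-slot (Weil's translation laws ★ `thetaKer_smul_left ∕ _right`, the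
datum's action ★ `lineThetaKernelDatum_act_s`, and §1). [cite: Weil1964, Chap. III n° 41 Thm 6 p. 193] [cite: GelbartRogawski1991, §3.2 p. 457] -/
theorem lineThetaKer_adelicCenter_smul (Φ : piSchwartzBruhat (↥(maximalRealSubfield L)) (Fin n'))
    (u : adelicOne (↥(maximalRealSubfield L)) L (IsCMField.complexConj L))
    (ξ : ↥(UnitaryGroup.adelic (↥(maximalRealSubfield L)) L (IsCMField.complexConj L) N (Matrix.diagonal dV)) ⧸
      (UnitaryGroup.toAdelic (↥(maximalRealSubfield L)) L (IsCMField.complexConj L) N (Matrix.diagonal dV)).range)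
    (q : ↥(UnitaryGroup.adelic (↥(maximalRealSubfield L)) L (IsCMField.complexConj L) 1 (JW (↥(maximalRealSubfield L)) L a)) ⧸
      (UnitaryGroup.toAdelic (↥(maximalRealSubfield L)) L (IsCMField.complexConj L) 1 (JW (↥(maximalRealSubfield L)) L a)).range) :
    (lineThetaKernelDatum L N e₁ dV hdV hdV0 μ hμ a hρ).thetaKer Φ
        (adelicCenter (↥(maximalRealSubfield L)) L (IsCMField.complexConj L) N (Matrix.diagonal dV) u • ξ, q) =
      (lineThetaKernelDatum L N e₁ dV hdV hdV0 μ hμ a hρ).thetaKer Φ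
        (ξ, adelicCenter (↥(maximalRealSubfield L)) L (IsCMField.complexConj L) 1 (JW (↥(maximalRealSubfield L)) L a) u • q) := by
  induction ξ using QuotientGroup.induction_on with
  | H x =>
    induction q using QuotientGroup.induction_on with
    | H y =>
      -- the quotient actions on representatives
      have e1 : adelicCenter (↥(maximalRealSubfield L)) L (IsCMField.complexConj L) N (Matrix.diagonal dV) u •
            (QuotientGroup.mk x : ↥(UnitaryGroup.adelic (↥(maximalRealSubfield L)) L (IsCMField.complexConj L) N (Matrix.diagonal dV)) ⧸
              (UnitaryGroup.toAdelic (↥(maximalRealSubfield L)) L (IsCMField.complexConj L) N (Matrix.diagonal dV)).range) =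
          QuotientGroup.mk (adelicCenter (↥(maximalRealSubfield L)) L (IsCMField.complexConj L) N (Matrix.diagonal dV) u * x) :=
        MulAction.Quotient.smul_mk _ _ _
      have e2 : adelicCenter (↥(maximalRealSubfield L)) L (IsCMField.complexConj L) 1 (JW (↥(maximalRealSubfield L)) L a) u •
            (QuotientGroup.mk y : ↥(UnitaryGroup.adelic (↥(maximalRealSubfield L)) L (IsCMField.complexConj L) 1 (JW (↥(maximalRealSubfield L)) L a)) ⧸
              (UnitaryGroup.toAdelic (↥(maximalRealSubfield L)) L (IsCMField.complexConj L) 1 (JW (↥(maximalRealSubfield L)) L a)).range) =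
          QuotientGroup.mk (adelicCenter (↥(maximalRealSubfield L)) L (IsCMField.complexConj L) 1 (JW (↥(maximalRealSubfield L)) L a) u * y) :=
        MulAction.Quotient.smul_mk _ _ _
      -- group algebra on the inverted representatives (closed-term rewrites only)
      have i1 : (adelicCenter (↥(maximalRealSubfield L)) L (IsCMField.complexConj L) N (Matrix.diagonal dV) u * x)⁻¹ =
          x⁻¹ * adelicCenter (↥(maximalRealSubfield L)) L (IsCMField.complexConj L) N (Matrix.diagonal dV) u⁻¹ := by
        rw [mul_inv_rev, map_inv]
      have i2 : (adelicCenter (↥(maximalRealSubfield L)) L (IsCMField.complexConj L) 1 (JW (↥(maximalRealSubfield L)) L a) u * y)⁻¹ =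
          adelicCenter (↥(maximalRealSubfield L)) L (IsCMField.complexConj L) 1 (JW (↥(maximalRealSubfield L)) L a) u⁻¹ * y⁻¹ := by
        rw [mul_inv_rev, ← map_inv (adelicCenter (↥(maximalRealSubfield L)) L (IsCMField.complexConj L) 1 (JW (↥(maximalRealSubfield L)) L a)) u]
        exact (adelicCenter_mul_comm _ _ _ _ _ u⁻¹ y⁻¹).symm
      -- the two splitting values agree (§1)
      have hpair : pairSplitting (↥(maximalRealSubfield L)) L (IsCMField.complexConj L) N 1 e₁ (Matrix.diagonal dV) (JW (↥(maximalRealSubfield L)) L a)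
            (chiSplittingLine L e₁ dV hdV hdV0 (toHeckeCharacter L μ) (isUnitary_toHeckeCharacter L μ)
              ((isOscillatorChar_toHeckeCharacter_iff μ).mpr hμ) (TW (↥(maximalRealSubfield L)) a)
              (isUnit_det_TW (↥(maximalRealSubfield L)) a) (JW (↥(maximalRealSubfield L)) L a) (JW_eq (↥(maximalRealSubfield L)) L a))
            ((adelicCenter (↥(maximalRealSubfield L)) L (IsCMField.complexConj L) N (Matrix.diagonal dV) u * x)⁻¹, y⁻¹) =
          pairSplitting (↥(maximalRealSubfield L)) L (IsCMField.complexConj L) N 1 e₁ (Matrix.diagonal dV) (JW (↥(maximalRealSubfield L)) L a)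
            (chiSplittingLine L e₁ dV hdV hdV0 (toHeckeCharacter L μ) (isUnitary_toHeckeCharacter L μ)
              ((isOscillatorChar_toHeckeCharacter_iff μ).mpr hμ) (TW (↥(maximalRealSubfield L)) a)
              (isUnit_det_TW (↥(maximalRealSubfield L)) a) (JW (↥(maximalRealSubfield L)) L a) (JW_eq (↥(maximalRealSubfield L)) L a))
            (x⁻¹, (adelicCenter (↥(maximalRealSubfield L)) L (IsCMField.complexConj L) 1 (JW (↥(maximalRealSubfield L)) L a) u * y)⁻¹) :=
        -- no rewriting under the splitting: transport the pair equalities by `congrArg` and chain with §1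
        ((congrArg _ (Prod.ext i1 rfl)).trans
          (pairSplitting_adelicCenter_swap (↥(maximalRealSubfield L)) L (IsCMField.complexConj L) N 1 e₁ (Matrix.diagonal dV)
            (JW (↥(maximalRealSubfield L)) L a) _ x⁻¹ y⁻¹ u⁻¹)).trans (congrArg _ (Prod.ext rfl i2.symm))
      rw [e1, e2]
      -- `θ_Φ(aΓ, bΓ) = Θ(ω(s_pair(a⁻¹, b⁻¹))Φ)` definitionally (★ `thetaKer_mk`, ★ `thetaKernelDatum_thetaFun_mk`)
      exact congrArg (thetaDistLM (↥(maximalRealSubfield L)) (Fin n'))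
        (congrArg (fun S => adelicMpCont.omega (↥(maximalRealSubfield L)) (Fin n') _ S Φ) hpair)

end Line

/-! ## §3 Leaf D8: central invariance of the doubled line theta integral -/

section Doubled

open Literature.NumberTheory.GelbartRogawski1991.GRConstruction
open Literature.NumberTheory.K2Lit.DoubledLineTheta

variable (L : Type) [Field L] [NumberField L] [IsCMField L]
variable {N M n : ℕ} (e : Fin N × Fin M ≃ Fin n)
  (dV : Fin N → L) (hdV : ∀ i, IsCMField.complexConj L (dV i) = dV i)
  (dW : Fin M → L) (hdW : ∀ i, IsCMField.complexConj L (dW i) = dW i)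
variable {n'' : ℕ} (e₁ : Fin (n + n) × Fin 1 ≃ Fin n'') (hdV0 : ∀ i, dV i ≠ 0) (hdW0 : ∀ i, dW i ≠ 0)
  (lam : Literature.NumberTheory.Automorphic.IdeleClassGroup L →ₜ* Circle) (hlam : IsConjugateSymplectic L lam)
  (a' : (↥(maximalRealSubfield L))ˣ)
  (hρ : HasThetaMajorants fun
      (p : ↥(UnitaryGroup.adelic (Fp L) L (IsCMField.complexConj L) (n + n) (Matrix.diagonal (dD L e dV hdV dW hdW))) ×
        ↥(UnitaryGroup.adelic (Fp L) L (IsCMField.complexConj L) 1 (JW (Fp L) L a')))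
      (Φ : piSchwartzBruhat (Fp L) (Fin n'')) =>
        pairRep (Fp L) L (IsCMField.complexConj L) (n + n) 1 e₁ (Matrix.diagonal (dD L e dV hdV dW hdW)) (JW (Fp L) L a')
          (chiSplittingLine L e₁ (dD L e dV hdV dW hdW) (dD_conj L e dV hdV dW hdW) (dD_ne_zero L e dV hdV dW hdW hdV0 hdW0)
            (toHeckeCharacter L lam) (isUnitary_toHeckeCharacter L lam)
            ((isOscillatorChar_toHeckeCharacter_iff lam).mpr hlam) (TW (Fp L) a')
            (isUnit_det_TW (Fp L) a') (JW (Fp L) L a') (JW_eq (Fp L) L a'))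
          p Φ)
  [MeasurableSpace (↥(UnitaryGroup.adelic (Fp L) L (IsCMField.complexConj L) 1 (JW (Fp L) L a')) ⧸
    (UnitaryGroup.toAdelic (Fp L) L (IsCMField.complexConj L) 1 (JW (Fp L) L a')).range)]
  [BorelSpace (↥(UnitaryGroup.adelic (Fp L) L (IsCMField.complexConj L) 1 (JW (Fp L) L a')) ⧸
    (UnitaryGroup.toAdelic (Fp L) L (IsCMField.complexConj L) 1 (JW (Fp L) L a')).range)]
  (μW : Measure (↥(UnitaryGroup.adelic (Fp L) L (IsCMField.complexConj L) 1 (JW (Fp L) L a')) ⧸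
    (UnitaryGroup.toAdelic (Fp L) L (IsCMField.complexConj L) 1 (JW (Fp L) L a')).range))
  [SMulInvariantMeasure (↥(UnitaryGroup.adelic (Fp L) L (IsCMField.complexConj L) 1 (JW (Fp L) L a')))
    (↥(UnitaryGroup.adelic (Fp L) L (IsCMField.complexConj L) 1 (JW (Fp L) L a')) ⧸
      (UnitaryGroup.toAdelic (Fp L) L (IsCMField.complexConj L) 1 (JW (Fp L) L a')).range) μW]

set_option maxHeartbeats 1000000 in -- idem
/-- **The doubled line theta lift under the CENTRE of `H(𝔸)`**: for `u ∈ U(1)(𝔸_{L⁺})` and the central element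
`z_u := toDiagA⁻¹(u·1_𝔻) ∈ H(𝔸)`, `Θ̃_Φ(f)(h · z_u) = Θ̃_Φ(λ((u·1_W)⁻¹) f)(h)` with `λ(k)f = f(k⁻¹ • ·)` (★ `Weil1964.leftTranslate`), i.e. the
weight is translated by the SAME `u` read in `U(⟨a′⟩)(𝔸)`: change of variables `q ↦ (u·1_W) • q` against the `U(⟨a′⟩)(𝔸)`-invariant `μW`
(Mathlib `integral_smul_eq_self`) after §2. [cite: Liu2021, App. B (B.7) p. 104] [cite: GelbartRogawski1991, §3.2 p. 457] -/
theorem doubledLineThetaLift_mul_centre (Φ : piSchwartzBruhat (Fp L) (Fin n''))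
    (f : C(↥(UnitaryGroup.adelic (Fp L) L (IsCMField.complexConj L) 1 (JW (Fp L) L a')) ⧸
      (UnitaryGroup.toAdelic (Fp L) L (IsCMField.complexConj L) 1 (JW (Fp L) L a')).range, ℂ))
    (h : HA L e dV hdV dW hdW) (u : adelicOne (Fp L) L (IsCMField.complexConj L)) :
    doubledLineThetaLift L e dV hdV dW hdW e₁ hdV0 hdW0 lam hlam a' hρ μW Φ f
        (h * (toDiagA L e dV hdV dW hdW).symm
          (adelicCenter (Fp L) L (IsCMField.complexConj L) (n + n) (Matrix.diagonal (dD L e dV hdV dW hdW)) u)) =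
      doubledLineThetaLift L e dV hdV dW hdW e₁ hdV0 hdW0 lam hlam a' hρ μW Φ
        (leftTranslate _ (adelicCenter (Fp L) L (IsCMField.complexConj L) 1 (JW (Fp L) L a') u)⁻¹ f) h := by
  haveI : MeasurableConstSMul (↥(UnitaryGroup.adelic (Fp L) L (IsCMField.complexConj L) 1 (JW (Fp L) L a')))
      (↥(UnitaryGroup.adelic (Fp L) L (IsCMField.complexConj L) 1 (JW (Fp L) L a')) ⧸
        (UnitaryGroup.toAdelic (Fp L) L (IsCMField.complexConj L) 1 (JW (Fp L) L a')).range) :=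
    ⟨fun k => (continuous_const_smul k).measurable⟩
  rw [doubledLineThetaLift_apply, doubledLineThetaLift_apply]
  -- the first variable: `(toDiagA (h·z_u))⁻¹ Γ = (u⁻¹·1_𝔻) • (toDiagA h)⁻¹ Γ`
  have hq : (QuotientGroup.mk (toDiagA L e dV hdV dW hdW (h * (toDiagA L e dV hdV dW hdW).symm
        (adelicCenter (Fp L) L (IsCMField.complexConj L) (n + n) (Matrix.diagonal (dD L e dV hdV dW hdW)) u)))⁻¹ :
      ↥(UnitaryGroup.adelic (Fp L) L (IsCMField.complexConj L) (n + n) (Matrix.diagonal (dD L e dV hdV dW hdW))) ⧸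
        (UnitaryGroup.toAdelic (Fp L) L (IsCMField.complexConj L) (n + n) (Matrix.diagonal (dD L e dV hdV dW hdW))).range) =
      adelicCenter (Fp L) L (IsCMField.complexConj L) (n + n) (Matrix.diagonal (dD L e dV hdV dW hdW)) u⁻¹ •
        QuotientGroup.mk (toDiagA L e dV hdV dW hdW h)⁻¹ := by
    rw [map_mul, MulEquiv.apply_symm_apply, mul_inv_rev, ← map_inv, MulAction.Quotient.smul_mk, smul_eq_mul]
  simp_rw [hq, lineThetaKer_adelicCenter_smul, map_inv]
  -- change of variables `q ↦ (u·1_W) • q` (`μW` invariant)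
  rw [← integral_smul_eq_self (μ := μW) (g := (adelicCenter (Fp L) L (IsCMField.complexConj L) 1 (JW (Fp L) L a') u)⁻¹)
    (f := fun q => (leftTranslate _ (adelicCenter (Fp L) L (IsCMField.complexConj L) 1 (JW (Fp L) L a') u)⁻¹ f) q *
      (lineThetaKernelDatum L (n + n) e₁ (dD L e dV hdV dW hdW) (dD_conj L e dV hdV dW hdW) (dD_ne_zero L e dV hdV dW hdW hdV0 hdW0) lam hlam
        a' hρ).thetaKer Φ (QuotientGroup.mk (toDiagA L e dV hdV dW hdW h)⁻¹, q))]
  refine integral_congr_ae (Filter.Eventually.of_forall fun q => ?_)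
  simp only [leftTranslate_apply, inv_inv, smul_inv_smul]

/-- **CENTRAL INVARIANCE OF THE DOUBLED LINE THETA INTEGRAL** (the weight-`1` case): `I(h · z_u; Φ) = I(h; Φ)` for every `u ∈ U(1)(𝔸_{L⁺})`,
`z_u = toDiagA⁻¹(u·1_𝔻)` the centre of `H(𝔸)`.  This is the tree fact behind the steward's finding that socket #42 AS TYPED (weight `1`) forces
the residue — whose central character is `χ_λ(u)²` — to vanish; the repaired socket uses ★ `doubledLineThetaLift` with a weight.
[cite: Liu2021, App. B (B.7), Prop. B.8 p. 104] [cite: GelbartRogawski1991, §3.2 p. 457] -/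
theorem doubledLineThetaIntegral_mul_centre (Φ : piSchwartzBruhat (Fp L) (Fin n'')) (h : HA L e dV hdV dW hdW)
    (u : adelicOne (Fp L) L (IsCMField.complexConj L)) :
    doubledLineThetaIntegral L e dV hdV dW hdW e₁ hdV0 hdW0 lam hlam a' hρ μW Φ
        (h * (toDiagA L e dV hdV dW hdW).symm
          (adelicCenter (Fp L) L (IsCMField.complexConj L) (n + n) (Matrix.diagonal (dD L e dV hdV dW hdW)) u)) =
      doubledLineThetaIntegral L e dV hdV dW hdW e₁ hdV0 hdW0 lam hlam a' hρ μW Φ h := by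
  have h1 := doubledLineThetaLift_mul_centre L e dV hdV dW hdW e₁ hdV0 hdW0 lam hlam a' hρ μW Φ 1 h u
  have h2 : leftTranslate _ (adelicCenter (Fp L) L (IsCMField.complexConj L) 1 (JW (Fp L) L a') u)⁻¹
      (1 : C(↥(UnitaryGroup.adelic (Fp L) L (IsCMField.complexConj L) 1 (JW (Fp L) L a')) ⧸
        (UnitaryGroup.toAdelic (Fp L) L (IsCMField.complexConj L) 1 (JW (Fp L) L a')).range, ℂ)) = 1 := by
    ext q
    rw [leftTranslate_apply, ContinuousMap.one_apply, ContinuousMap.one_apply]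
  rw [h2] at h1
  exact h1

end Doubled

end Summit.HodgeConjecture.HodgeConjecture.Cruxes.HLiu418.K2LiuLineThetaCentreAbsorb

end
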